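import Literature.MathematicalPhysics.QuantumLattice.SpinPartialTrace
import Literature.InformationTheory.Entropy.ConditionalEntropyConcavity
import HarnessLib

/-!
# The partial trace is a conditional expectation: bimodule property and unitary covariance

For a site injection `φ : X ↪ Y` the partial trace `tr := spinPartialTrace φ : 𝔄_Y → 𝔄_X`
(`SpinPartialTrace.lean`; Nielsen–Chuang's reduced density operator, the Hilbert–Schmidt adjoint of
`Γ_φ = spinEmbed φ`) satisfies the two algebraic identities of a conditional expectation
[cite: NielsenChuang2010, §2.4.3 Box 2.6 eqs. (2.180)–(2.182)] [cite: BratteliRobinsonII1997, §6.2.1]: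

* **bimodule property** `tr (Γ_φ A · σ · Γ_φ B) = A · tr σ · B`
  (`spinPartialTrace_spinEmbed_mul_mul_spinEmbed`, one-sided forms `spinPartialTrace_spinEmbed_mul`,
  `spinPartialTrace_mul_spinEmbed`);
* **operators on the traced-out sites move through** `tr (W σ) = tr (σ W)` for `W = Γ_ψ C` embedded
  along an injection `ψ` whose range is disjoint from that of `φ` (`spinPartialTrace_spinEmbed_mul_comm`).

Consequences used by symmetrised SDP relaxations of lattice models (a finite symmetry group acting on
a window by PRODUCT unitaries `U = Γ_φ U_X · Γ_ψ U_Z`, e.g. a global spin flip or particle–hole map):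
**covariance** `tr (U σ U⋆) = U_X (tr σ) U_X⋆` (`spinPartialTrace_productUnitary_conj`) and hence the
invariance of the marginal entropy `S(tr (U σ U⋆)) = S(tr σ)`
(`vonNeumannEntropy_spinPartialTrace_productUnitary_conj`, with `vonNeumannEntropy_unitary_conj` of
`ConditionalEntropyConcavity.lean`), so that the window entropy antecedent `0 ≤ S(σ) − S(tr σ)` is the
same for `σ` and for `U σ U⋆` (`entropy_sub_spinPartialTrace_productUnitary_conj`).
[cite: FawziFawziScalet2024Entropy, Theorem 4.1]
-/

open Matrix
open scoped BigOperators ComplexOrder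

namespace Literature.MathematicalPhysics.QuantumLattice

open Literature.InformationTheory.Entropy (vonNeumannEntropy vonNeumannEntropy_unitary_conj)

variable {X Y Z : Type*} [Fintype X] [DecidableEq X] [Fintype Y] [DecidableEq Y]
  [Fintype Z] [DecidableEq Z] {q : ℕ}

/-- **Bimodule property of the partial trace**: `tr_{Y∖X} (Γ_φ A · σ · Γ_φ B) = A · tr_{Y∖X} σ · B` for
`A, B ∈ 𝔄_X` — tested against every `T ∈ 𝔄_X` through the defining duality
`tr (T · tr σ) = tr (Γ_φ T · σ)`, multiplicativity of `Γ_φ` and cyclicity of the trace.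
[cite: NielsenChuang2010, §2.4.3 Box 2.6 eqs. (2.180)–(2.182)] [cite: BratteliRobinsonII1997, §6.2.1] -/
theorem spinPartialTrace_spinEmbed_mul_mul_spinEmbed (φ : X ↪ Y) (A B : Op X q) (σ : Op Y q) :
    spinPartialTrace φ (spinEmbed φ A * σ * spinEmbed φ B) = A * spinPartialTrace φ σ * B := by
  symm
  refine eq_spinPartialTrace_of_forall_trace_mul φ _ fun T => ?_
  calc (T * (A * spinPartialTrace φ σ * B)).trace
      = ((B * T * A) * spinPartialTrace φ σ).trace := by
        rw [← Matrix.mul_assoc T, Matrix.trace_mul_comm]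
        simp only [Matrix.mul_assoc]
    _ = (spinEmbed φ (B * T * A) * σ).trace := trace_mul_spinPartialTrace φ _ σ
    _ = (spinEmbed φ T * (spinEmbed φ A * σ * spinEmbed φ B)).trace := by
        rw [map_mul, map_mul]
        conv_rhs => rw [← Matrix.mul_assoc, Matrix.trace_mul_comm]
        simp only [Matrix.mul_assoc]

/-- `tr_{Y∖X} (Γ_φ A · σ) = A · tr_{Y∖X} σ`. [cite: NielsenChuang2010, §2.4.3 Box 2.6 eqs. (2.180)–(2.182)] -/
theorem spinPartialTrace_spinEmbed_mul (φ : X ↪ Y) (A : Op X q) (σ : Op Y q) :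
    spinPartialTrace φ (spinEmbed φ A * σ) = A * spinPartialTrace φ σ := by
  have h := spinPartialTrace_spinEmbed_mul_mul_spinEmbed φ A 1 σ
  rwa [map_one, Matrix.mul_one, Matrix.mul_one] at h

/-- `tr_{Y∖X} (σ · Γ_φ B) = tr_{Y∖X} σ · B`. [cite: NielsenChuang2010, §2.4.3 Box 2.6 eqs. (2.180)–(2.182)] -/
theorem spinPartialTrace_mul_spinEmbed (φ : X ↪ Y) (σ : Op Y q) (B : Op X q) :
    spinPartialTrace φ (σ * spinEmbed φ B) = spinPartialTrace φ σ * B := by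
  have h := spinPartialTrace_spinEmbed_mul_mul_spinEmbed φ 1 B σ
  rwa [map_one, Matrix.one_mul, Matrix.one_mul] at h

/-- **Operators on the traced-out sites move through the partial trace**: for `W = Γ_ψ C` embedded
along an injection `ψ : Z ↪ Y` with range disjoint from that of `φ`, `tr_{Y∖X} (W σ) = tr_{Y∖X} (σ W)`
(`W` commutes with every `Γ_φ T`; cyclicity of the trace).
[cite: NielsenChuang2010, §2.4.3 Box 2.6 eqs. (2.180)–(2.182)] [cite: BratteliRobinsonII1997, §6.2.1] -/
theorem spinPartialTrace_spinEmbed_mul_comm (φ : X ↪ Y) (ψ : Z ↪ Y)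
    (h : Disjoint (rangeSites φ) (rangeSites ψ)) (C : Op Z q) (σ : Op Y q) :
    spinPartialTrace φ (spinEmbed ψ C * σ) = spinPartialTrace φ (σ * spinEmbed ψ C) := by
  symm
  refine eq_spinPartialTrace_of_forall_trace_mul φ _ fun T => ?_
  rw [trace_mul_spinPartialTrace, ← Matrix.mul_assoc, Matrix.trace_mul_cycle, ← Matrix.mul_assoc,
    (spinEmbed_commute_spinEmbed φ ψ T C h).eq]

/-- **Covariance of the partial trace under product unitaries**: for `U = Γ_φ U_X · Γ_ψ U_Z` with
`U_X`, `U_Z` unitary and `φ`, `ψ` of disjoint ranges, `tr_{Y∖X} (U σ U⋆) = U_X · tr_{Y∖X} σ · U_X⋆`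
(the factor on the traced-out sites cancels: `tr (Γ_ψ U_Z σ Γ_ψ U_Z⋆) = tr (σ Γ_ψ (U_Z⋆ U_Z)) = tr σ`).
[cite: NielsenChuang2010, §2.4.3 Box 2.6 eqs. (2.180)–(2.182)] [cite: BratteliRobinsonII1997, §6.2.1] -/
theorem spinPartialTrace_productUnitary_conj (φ : X ↪ Y) (ψ : Z ↪ Y)
    (h : Disjoint (rangeSites φ) (rangeSites ψ)) (UX : Op X q) {UZ : Op Z q}
    (hUZ : UZ ∈ Matrix.unitaryGroup (TensorIndex Z q) ℂ) (σ : Op Y q) :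
    spinPartialTrace φ ((spinEmbed φ UX * spinEmbed ψ UZ) * σ * (spinEmbed φ UX * spinEmbed ψ UZ)ᴴ) =
      UX * spinPartialTrace φ σ * UXᴴ := by
  have hZ : UZᴴ * UZ = 1 := by
    simpa [Matrix.star_eq_conjTranspose] using Matrix.mem_unitaryGroup_iff'.mp hUZ
  rw [Matrix.conjTranspose_mul, ← spinEmbed_conjTranspose, ← spinEmbed_conjTranspose]
  -- regroup as Γ_φ UX · (Γ_ψ UZ · σ · Γ_ψ UZᴴ) · Γ_φ UXᴴ
  have hre : spinEmbed φ UX * spinEmbed ψ UZ * σ * (spinEmbed ψ UZᴴ * spinEmbed φ UXᴴ) =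
      spinEmbed φ UX * (spinEmbed ψ UZ * σ * spinEmbed ψ UZᴴ) * spinEmbed φ UXᴴ := by
    simp only [Matrix.mul_assoc]
  have hmid : spinPartialTrace φ (spinEmbed ψ UZ * σ * spinEmbed ψ UZᴴ) = spinPartialTrace φ σ := by
    rw [Matrix.mul_assoc, spinPartialTrace_spinEmbed_mul_comm φ ψ h UZ, Matrix.mul_assoc, ← map_mul, hZ,
      map_one, Matrix.mul_one]
  rw [hre, spinPartialTrace_spinEmbed_mul_mul_spinEmbed, hmid]

/-- **The marginal entropy is invariant under product unitaries**: `S(tr_{Y∖X} (U σ U⋆)) = S(tr_{Y∖X} σ)`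
for `U = Γ_φ U_X · Γ_ψ U_Z` as above and `σ` Hermitian.
[cite: NielsenChuang2010, Theorem 11.8 (3) (proof) p.513; §2.4.3 Box 2.6] -/
theorem vonNeumannEntropy_spinPartialTrace_productUnitary_conj {X Y Z : Type} [Fintype X] [DecidableEq X]
    [Fintype Y] [DecidableEq Y] [Fintype Z] [DecidableEq Z] {q : ℕ} (φ : X ↪ Y) (ψ : Z ↪ Y)
    (h : Disjoint (rangeSites φ) (rangeSites ψ)) {UX : Op X q} {UZ : Op Z q}
    (hUX : UX ∈ Matrix.unitaryGroup (TensorIndex X q) ℂ) (hUZ : UZ ∈ Matrix.unitaryGroup (TensorIndex Z q) ℂ)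
    {σ : Op Y q} (hσ : σ.IsHermitian) :
    vonNeumannEntropy (spinPartialTrace φ
        ((spinEmbed φ UX * spinEmbed ψ UZ) * σ * (spinEmbed φ UX * spinEmbed ψ UZ)ᴴ)) =
      vonNeumannEntropy (spinPartialTrace φ σ) := by
  rw [spinPartialTrace_productUnitary_conj φ ψ h UX hUZ σ]
  exact vonNeumannEntropy_unitary_conj hUX (isHermitian_spinPartialTrace φ hσ)

/-- **The window entropy antecedent is invariant under product unitaries**:
`S(U σ U⋆) − S(tr_{Y∖X} (U σ U⋆)) = S(σ) − S(tr_{Y∖X} σ)` for `U = Γ_φ U_X · Γ_ψ U_Z` as above — so in a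
`G`-symmetrised entropy-constrained relaxation every term `U_g ρ U_g⋆` of the averaged feasible point
satisfies the entropy constraint as soon as `ρ` does (the average then does by concavity,
`WindowEntropyConcavity.lean`). [cite: FawziFawziScalet2024Entropy, Theorem 4.1]
[cite: NielsenChuang2010, Theorem 11.8 (3) p.513] -/
theorem entropy_sub_spinPartialTrace_productUnitary_conj {X Y Z : Type} [Fintype X] [DecidableEq X]
    [Fintype Y] [DecidableEq Y] [Fintype Z] [DecidableEq Z] {q : ℕ} (φ : X ↪ Y) (ψ : Z ↪ Y)
    (h : Disjoint (rangeSites φ) (rangeSites ψ)) {UX : Op X q} {UZ : Op Z q}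
    (hUX : UX ∈ Matrix.unitaryGroup (TensorIndex X q) ℂ) (hUZ : UZ ∈ Matrix.unitaryGroup (TensorIndex Z q) ℂ)
    {σ : Op Y q} (hσ : σ.IsHermitian) :
    vonNeumannEntropy ((spinEmbed φ UX * spinEmbed ψ UZ) * σ * (spinEmbed φ UX * spinEmbed ψ UZ)ᴴ) -
        vonNeumannEntropy (spinPartialTrace φ
          ((spinEmbed φ UX * spinEmbed ψ UZ) * σ * (spinEmbed φ UX * spinEmbed ψ UZ)ᴴ)) =
      vonNeumannEntropy σ - vonNeumannEntropy (spinPartialTrace φ σ) := by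
  have hU : spinEmbed φ UX * spinEmbed ψ UZ ∈ Matrix.unitaryGroup (TensorIndex Y q) ℂ := by
    have hX : UXᴴ * UX = 1 := by
      simpa [Matrix.star_eq_conjTranspose] using Matrix.mem_unitaryGroup_iff'.mp hUX
    have hZ : UZᴴ * UZ = 1 := by
      simpa [Matrix.star_eq_conjTranspose] using Matrix.mem_unitaryGroup_iff'.mp hUZ
    refine Matrix.mem_unitaryGroup_iff'.mpr ?_
    rw [Matrix.star_eq_conjTranspose, Matrix.conjTranspose_mul, ← spinEmbed_conjTranspose,
      ← spinEmbed_conjTranspose, Matrix.mul_assoc, ← Matrix.mul_assoc (spinEmbed φ UXᴴ),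
      ← map_mul, hX, map_one, Matrix.one_mul, ← map_mul, hZ, map_one]
  rw [vonNeumannEntropy_spinPartialTrace_productUnitary_conj φ ψ h hUX hUZ hσ,
    vonNeumannEntropy_unitary_conj hU hσ]

end Literature.MathematicalPhysics.QuantumLattice
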